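import Summits.CriticalPhenomena.Ising3DConformalLimit.Theses.HelsonAxis
import Literature.Probability.LatticeModels.CriticalTwoPointLawDimension
import HarnessLib

/-!
# `TwoPointSpineComplement` (item stmt-CriticalPhenomena-4497): the amplitude positivity `0 < c` is load-bearing

Negative lemma (refuter, crux-attack at birth of route `HelsonAxis`, 2026-08-17; `--supports stmt-CriticalPhenomena-4497`).
The crux reads `∀ Δ c, 0 < c → (⟨σ₀σ_x⟩_{β_c(3)}·|x|₂^{2Δ} → c cofinitely) → ∃ ρ S, … ∧ 0 < Δ ∧ …`.
Dropping the single hypothesis `0 < c` makes it FALSE for a junk reason: with `Δ = 0`, `c = 0` the "law"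
`⟨σ₀σ_x⟩·|x|^0 → 0` is the tree theorem `criticalTwoPoint_tendsto_zero_cofinite` (infrared bound,
`criticalTwoPoint_bounds_holds`), while the conclusion demands `0 < Δ = 0`. So any proof of the crux must use `0 < c`
(it is what pins `Δ ∈ [1/2, 1]`, `twoPointLaw_exponent_mem_Icc`). No statement of the route is refuted here.
-/

namespace Summit.CriticalPhenomena.Ising3DConformalLimit.TwoPointSpineComplement.Negative

open Literature.Probability.LatticeModels Filter Topology

/-- **`0 < c` is load-bearing in `TwoPointSpineComplement`.** The crux with the amplitude-positivity hypothesis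
dropped is false: witness `Δ = 0`, `c = 0` (the critical two-point function of `ℤ³` tends to `0` at infinity,
`criticalTwoPoint_tendsto_zero_cofinite`, yet the conclusion asks `0 < Δ`). [folklore] -/
theorem twoPointSpineComplement_false_without_posAmplitude :
    ¬ (∀ Δ c : ℝ, Tendsto (fun x : Site 3 =>
        criticalTwoPoint 3 x * Real.sqrt (∑ i, ((x i : ℝ)) ^ 2) ^ (2 * Δ)) cofinite (nhds c) →
      ∃ (ρ : ℝ → ℝ) (S : CorrFamily 3), (∀ δ ∈ Set.Ioc (0:ℝ) 1, 0 < ρ δ) ∧ 0 < Δ ∧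
        HasPointwiseScalingLimit (criticalCorr 3) ρ S ∧ IsNondegenerateTwoPoint S ∧
        IsMoebiusCovariant Δ S ∧ HasNontrivialU4 S) := by
  intro h
  have hlaw : Tendsto (fun x : Site 3 =>
      criticalTwoPoint 3 x * Real.sqrt (∑ i, ((x i : ℝ)) ^ 2) ^ (2 * (0 : ℝ))) cofinite (nhds 0) := by
    simpa using criticalTwoPoint_tendsto_zero_cofinite
  obtain ⟨-, -, -, hΔ, -⟩ := h 0 0 hlaw
  exact lt_irrefl _ hΔ

/-- The same fact read against the route decl: `TwoPointSpineComplement` is exactly its `0 < c`-guarded form,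
so the guard cannot be removed (restatement tying the negative lemma to the decl by name). [folklore] -/
theorem twoPointSpineComplement_iff_guarded :
    Summit.CriticalPhenomena.Ising3DConformalLimit.Theses.HelsonAxis.TwoPointSpineComplement ↔
    (∀ Δ c : ℝ, 0 < c → Tendsto (fun x : Site 3 =>
        criticalTwoPoint 3 x * Real.sqrt (∑ i, ((x i : ℝ)) ^ 2) ^ (2 * Δ)) cofinite (nhds c) →
      ∃ (ρ : ℝ → ℝ) (S : CorrFamily 3), (∀ δ ∈ Set.Ioc (0:ℝ) 1, 0 < ρ δ) ∧ 0 < Δ ∧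
        HasPointwiseScalingLimit (criticalCorr 3) ρ S ∧ IsNondegenerateTwoPoint S ∧
        IsMoebiusCovariant Δ S ∧ HasNontrivialU4 S) :=
  Iff.rfl

end Summit.CriticalPhenomena.Ising3DConformalLimit.TwoPointSpineComplement.Negative
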